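import Summits.BirchSwinnertonDyer.BirchSwinnertonDyer.Theorems.CyclotomicUntwistPSTwistInvolutionUnitPart
import HarnessLib

/-!
# LAW L-tw3: the `χ₋₃`-TWIST INVOLUTION of the principal-series rows of route `CyclotomicUntwist` —
# dictionary `II 4 ↔ IV* 10`, `IV 6 ↔ II* 12`, Kraus order `3 ↔ 6`, `c₃`, conductor `N(E ⊗ χ₋₃) = N(E)`,
# symmetry of the pair, and the summary on the K1/K2 rows

Cell `pub/bsd-wall` (D-0145 line `route-BirchSwinnertonDyer-CyclotomicUntwist`), seat `bsd-line-cycu-p4`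
(width seat 4, gen 5). Helper toward the cruxes K1 `PSRankOneLowerHalfAtThree`
(stmt-BirchSwinnertonDyer-21580) and K2 `PSRankOneUpperHalfAtThree` (stmt-21581). THEOREMS ONLY (no
definition, no named fact, no `sorry`); route-free; BSD is not proved by this file and no crux is. Third file of
LAW L-tw3 after `…PSTwistInvolutionKodaira` (Kodaira layer) and `…PSTwistInvolutionUnitPart` (unit part, PS ↦ PS,
`W₃ ↦ −W₃`). Throughout `V` is globally minimal on the cyclic wild cell at `3` (`ClassO6 V 3`, `v := v₃Δ_min(V)`
even), `d = ±3`, and `W` is a globally minimal model of the twist, `C • V^{(d)} = W`.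

* §6 `padicValInt_minimalDiscriminantInt_twist_eq_ite` (`v₃Δ_min(W) = v + 6` if `v ≤ 6`, else `v − 6`);
  **`kodairaSymbolAt_and_padicValInt_twist_of_cyclic`**: `(V, W) ∈ {(II 4, IV* 10), (IV 6, II* 12),
  (IV* 10, II 4), (II* 12, IV 6)}`; **`krausInertiaOrderThree_twist_of_cyclic`: `#Φ` is `3` on one side and `6`
  on the other** (the route's `η` of order `3` vs `6 = 2·3`); `localTamagawaNumber_three_twist_eq_one_of_mod_four_eq_two`:
  the twist of a `IV`/`IV*` curve has `c₃ = 1` (K2's factor `c₃ = 3` lives on one side of the involution only).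
* §9 **`conductorNorm_twist_negThree_of_cyclic`: `N(E ⊗ χ₋₃) = N(E)`** (`d = −3 = 3*`): `f₃ = 4` on both sides
  (`PSKodairaDictionary.condExp_eq_four_iff_even`), `f_ℓ` unchanged for `ℓ ≠ 3` (unramified twist,
  `Additive.conductorExponent_eq_of_twist_pStar_of_ne`) — `E` and `E ⊗ χ₋₃` have newforms of the same level `81M`
  (and one untwist `g` of level `9M`).
* §10 `exists_minimal_twist_pm_three` (a globally minimal `W` exists, *AEC* VIII.8.3) and
  **`exists_variableChange_twist_symm`**: `C • V^{(d)} = W ⟹ C′ • W^{(d)} = V` — the twist is an involution on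
  `ℚ`-isomorphism classes, so every statement reads both ways.
* §11 **`twist_involution_of_psRow`** — summary on the PS rows of K1/K2 for `d = −3`: `W` is again on a PS row,
  `v₃Δ_min(W) = v ± 6`, `W₃(W) = −W₃(V)`, `N(W) = N(V)`. Analytic rank and `ρ̄₃` are not claimed preserved.

References: A. Kraus, Manuscripta Math. 69 (1990) [Kraus1990]; N. Coppola, Res. Number Theory 6 (2020) Thm. 2.7
[Coppola2020]; O. G. Rizzo, Compositio Math. 136 (2003), Table II [Rizzo2003]; I. Papadopoulos, J. Number Theory
44 (1993), Table III [Papadopoulos1993]; J. H. Silverman, *AEC* (2009) VIII.8.3, X.2, X.5, C.16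
[SilvermanAEC2009]; *ATAEC* (1994) IV.9.4, IV.10.4 [SilvermanATAEC1994].
-/

open scoped Classical

open WeierstrassCurve IsDedekindDomain Rat.HeightOneSpectrum Literature.NumberTheory.EllipticCurves
  Literature.NumberTheory.EllipticCurves.Rank1Residual Literature.NumberTheory.DiophantineGeometry
  Summit.BirchSwinnertonDyer.Rank1Residual.Additive

set_option linter.dupNamespace false -- single-conjunct summit: the name repeats by design
set_option autoImplicit false

namespace Summit.BirchSwinnertonDyer.BirchSwinnertonDyer.Theorems.PSTwistInvolution

/-! ### §6 The Kodaira dictionary across the twist, in one statement -/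

section Dictionary

variable (V W : WeierstrassCurve ℚ) [V.IsElliptic] [V.IsGloballyMinimal] [W.IsElliptic] [W.IsGloballyMinimal]

/-- **The involution on `v₃Δ_min`**, compact form: `v₃Δ_min(W) = v + 6` if `v ≤ 6` and `v − 6` otherwise
(`v := v₃Δ_min(V)`). [cite: Papadopoulos1993, Table III (p = 3)] [cite: SilvermanAEC2009, X.2 Prop. 2.4] -/
theorem padicValInt_minimalDiscriminantInt_twist_eq_ite (hO6 : ClassO6 V 3)
    (hev : Even (padicValInt 3 V.minimalDiscriminantInt)) {d : ℤ} (hd : d = 3 ∨ d = -3)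
    (C : VariableChange ℚ) (hC : C • V.quadraticTwist (d : ℚ) = W) :
    padicValInt 3 W.minimalDiscriminantInt =
      if padicValInt 3 V.minimalDiscriminantInt ≤ 6 then padicValInt 3 V.minimalDiscriminantInt + 6
      else padicValInt 3 V.minimalDiscriminantInt - 6 := by
  rcases padicValInt_minimalDiscriminantInt_twist_of_cyclic V W hO6 hev hd C hC with
    ⟨hv, hw, -⟩ | ⟨hv, hw, -⟩ | ⟨hv, hw, -⟩ | ⟨hv, hw, -⟩ <;> rw [hv, hw] <;> decide

/-- **Kodaira symbols across the twist, as a dictionary**: `(V, W)` is `(II 4, IV* 10)`, `(IV 6, II* 12)`,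
`(IV* 10, II 4)` or `(II* 12, IV 6)` (Kodaira symbol at `3`, `v₃Δ_min`).
[cite: Papadopoulos1993, Table III (p = 3)] [cite: SilvermanATAEC1994, Table 4.1] -/
theorem kodairaSymbolAt_and_padicValInt_twist_of_cyclic (hO6 : ClassO6 V 3)
    (hev : Even (padicValInt 3 V.minimalDiscriminantInt)) {d : ℤ} (hd : d = 3 ∨ d = -3)
    (C : VariableChange ℚ) (hC : C • V.quadraticTwist (d : ℚ) = W) :
    (V.kodairaSymbolAt (placeOf 3) = .II ∧ padicValInt 3 V.minimalDiscriminantInt = 4 ∧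
        W.kodairaSymbolAt (placeOf 3) = .IVstar ∧ padicValInt 3 W.minimalDiscriminantInt = 10) ∨
      (V.kodairaSymbolAt (placeOf 3) = .IV ∧ padicValInt 3 V.minimalDiscriminantInt = 6 ∧
        W.kodairaSymbolAt (placeOf 3) = .IIstar ∧ padicValInt 3 W.minimalDiscriminantInt = 12) ∨
      (V.kodairaSymbolAt (placeOf 3) = .IVstar ∧ padicValInt 3 V.minimalDiscriminantInt = 10 ∧
        W.kodairaSymbolAt (placeOf 3) = .II ∧ padicValInt 3 W.minimalDiscriminantInt = 4) ∨
      (V.kodairaSymbolAt (placeOf 3) = .IIstar ∧ padicValInt 3 V.minimalDiscriminantInt = 12 ∧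
        W.kodairaSymbolAt (placeOf 3) = .IV ∧ padicValInt 3 W.minimalDiscriminantInt = 6) := by
  have hKV := PSKodairaDictionary.kodairaSymbolAt_of_even V hO6.2.1 hO6.2.2 hev
  have hKW := kodairaSymbolAt_twist_of_cyclic V W hO6 hev hd C hC
  have hvW := padicValInt_minimalDiscriminantInt_twist_of_cyclic V W hO6 hev hd C hC
  rcases hKV with ⟨hK, hv⟩ | ⟨hK, hv⟩ | ⟨hK, hv⟩ | ⟨hK, hv⟩ <;> rw [hv] at hKW hvW <;>
    rcases hKW with ⟨hK', h'⟩ | ⟨hK', h'⟩ | ⟨hK', h'⟩ | ⟨hK', h'⟩ <;> norm_num at h' <;>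
    rcases hvW with ⟨h'', hw, -⟩ | ⟨h'', hw, -⟩ | ⟨h'', hw, -⟩ | ⟨h'', hw, -⟩ <;> norm_num at h''
  · exact Or.inl ⟨hK, hv, hK', hw⟩
  · exact Or.inr (Or.inl ⟨hK, hv, hK', hw⟩)
  · exact Or.inr (Or.inr (Or.inl ⟨hK, hv, hK', hw⟩))
  · exact Or.inr (Or.inr (Or.inr ⟨hK, hv, hK', hw⟩))

/-- **Kraus's inertia order across the twist: `3 ↔ 6`** (`#Φ = 3` on `II`/`II*`, `6` on `IV`/`IV*`; the
route's untwisting character has order `3` on one side and `6 = 2·3` — an extra `χ₋₃` — on the other).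
[cite: Kraus1990, Théorème (p = 3)] [cite: Coppola2020, Thm. 2.7] -/
theorem krausInertiaOrderThree_twist_of_cyclic (hO6 : ClassO6 V 3)
    (hev : Even (padicValInt 3 V.minimalDiscriminantInt)) {d : ℤ} (hd : d = 3 ∨ d = -3)
    (C : VariableChange ℚ) (hC : C • V.quadraticTwist (d : ℚ) = W) :
    (krausInertiaOrderThree V = 3 ∧ krausInertiaOrderThree W = 6) ∨
      (krausInertiaOrderThree V = 6 ∧ krausInertiaOrderThree W = 3) := by
  have hO6W := classO6_twist_of_cyclic W V hO6 hev hd C hC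
  have hevW := even_twist_of_cyclic V W hO6 hev hd C hC
  obtain ⟨hV3, hV6⟩ := PSKodairaDictionary.krausInertiaOrderThree_of_even V hO6.2.1 hO6.2.2 hev
  obtain ⟨hW3, hW6⟩ := PSKodairaDictionary.krausInertiaOrderThree_of_even W hO6W.2.1 hO6W.2.2 hevW
  rcases padicValInt_minimalDiscriminantInt_twist_of_cyclic V W hO6 hev hd C hC with
    ⟨hv, hw, -⟩ | ⟨hv, hw, -⟩ | ⟨hv, hw, -⟩ | ⟨hv, hw, -⟩ <;> rw [hv] at hV3 hV6 <;> rw [hw] at hW3 hW6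
  · exact Or.inl ⟨hV3 (by norm_num), hW6 (by norm_num)⟩
  · exact Or.inr ⟨hV6 (by norm_num), hW3 (by norm_num)⟩
  · exact Or.inr ⟨hV6 (by norm_num), hW3 (by norm_num)⟩
  · exact Or.inl ⟨hV3 (by norm_num), hW6 (by norm_num)⟩

/-- **The Tamagawa number at `3` of the twist of a `IV`/`IV*` curve is `1`** (its partner is `II*`/`II`, where
`c₃ = 1`, Tate Steps 3/10): the factor `c₃ = 3` of K2's obstacle lives on one side of the involution only.
[cite: SilvermanATAEC1994, IV.9.4 Steps 3 and 10] [cite: Papadopoulos1993, Table III (p = 3)] -/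
theorem localTamagawaNumber_three_twist_eq_one_of_mod_four_eq_two (hO6 : ClassO6 V 3)
    (hev : Even (padicValInt 3 V.minimalDiscriminantInt))
    (h2 : padicValInt 3 V.minimalDiscriminantInt % 4 = 2) {d : ℤ} (hd : d = 3 ∨ d = -3)
    (C : VariableChange ℚ) (hC : C • V.quadraticTwist (d : ℚ) = W) :
    (W.baseChange ℚ_[3]).localTamagawaNumber ℤ_[3] = 1 := by
  have hO6W := classO6_twist_of_cyclic W V hO6 hev hd C hC
  refine PSKodairaDictionary.localTamagawaNumber_three_eq_one_of_four_dvd W hO6W.2.1 hO6W.2.2 ?_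
  rcases padicValInt_minimalDiscriminantInt_twist_of_cyclic V W hO6 hev hd C hC with
    ⟨hv, hw, -⟩ | ⟨hv, hw, -⟩ | ⟨hv, hw, -⟩ | ⟨hv, hw, -⟩ <;> rw [hv] at h2 <;> rw [hw] <;> omega

end Dictionary

/-! ### §9 The conductor is unchanged by the `χ₋₃`-twist (`d = −3 = 3*`) on the cyclic cell -/

section Conductor

variable (V W : WeierstrassCurve ℚ) [V.IsElliptic] [V.IsGloballyMinimal] [W.IsElliptic] [W.IsGloballyMinimal]

/-- **`N(E ⊗ χ₋₃) = N(E)` on the cyclic wild cell at `3`.** For `C • V^{(−3)} = W`: at `3` both conductor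
exponents are `4` (`PSKodairaDictionary.condExp_eq_four_iff_even`, both sides cyclic); away from `3` the twist by
`−3 = 3* ≡ 1 (mod 4)` is unramified and `f_v` is unchanged (`Additive.conductorExponent_eq_of_twist_pStar_of_ne`);
`N = ∏ p^{f_p}`. So `E` and `E ⊗ χ₋₃` have newforms of the same level `N = 81·M` — and the SAME untwist
`g = f_E ⊗ η̄` of level `9M`. [cite: SilvermanAEC2009, C.16] [cite: SilvermanATAEC1994, IV.9.4 and IV.10.4] -/
theorem conductorNorm_twist_negThree_of_cyclic (hO6 : ClassO6 V 3)
    (hev : Even (padicValInt 3 V.minimalDiscriminantInt)) (C : VariableChange ℚ)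
    (hC : C • V.quadraticTwist ((-3 : ℤ) : ℚ) = W) : W.conductorNorm ℤ = V.conductorNorm ℤ := by
  have hd : (-3 : ℤ) = 3 ∨ (-3 : ℤ) = -3 := Or.inr rfl
  have hO6W := classO6_twist_of_cyclic W V hO6 hev hd C hC
  have hevW := even_twist_of_cyclic V W hO6 hev hd C hC
  have hC' : C • V.quadraticTwist ((-1 : ℚ) ^ (3 / 2) * 3) = W := by
    rw [← hC]; norm_num
  refine Nat.eq_of_factorization_eq (W.conductorNorm_pos_holds).ne' (V.conductorNorm_pos_holds).ne' fun q ↦ ?_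
  by_cases hq : q.Prime
  · haveI : Fact q.Prime := ⟨hq⟩
    have hgen : natGenerator (placeOf q) = q :=
      Literature.NumberTheory.EllipticCurves.Rat.natGenerator_primesEquiv_symm ⟨q, hq⟩
    have hW' := W.factorization_conductorNorm_holds (placeOf q)
    have hV' := V.factorization_conductorNorm_holds (placeOf q)
    rw [hgen] at hW' hV'
    rw [hW', hV']
    by_cases hq3 : q = 3
    · subst hq3
      have h1 : condExp W 3 = 4 := (PSKodairaDictionary.condExp_eq_four_iff_even W hO6W.2.1 hO6W.2.2).mpr hevW
      have h2 : condExp V 3 = 4 := (PSKodairaDictionary.condExp_eq_four_iff_even V hO6.2.1 hO6.2.2).mpr hev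
      unfold condExp at h1 h2
      rw [h1, h2]
    · exact conductorExponent_eq_of_twist_pStar_of_ne 3 (by norm_num) V W C hC' (placeOf q)
        (by rw [hgen]; exact hq3)
  · rw [Nat.factorization_eq_zero_of_not_prime _ hq, Nat.factorization_eq_zero_of_not_prime _ hq]

end Conductor

/-! ### §10 Existence and symmetry of the twist pair -/

section Symmetry

variable (V : WeierstrassCurve ℚ) [V.IsElliptic]

/-- **Every curve has a globally minimal model of its `±3`-twist** (Néron / Silverman *AEC* VIII.8.3 over `ℚ`,
tree `hasGlobalMinimalModel_rat_holds`). [cite: SilvermanAEC2009, VIII.8.3] -/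
theorem exists_minimal_twist_pm_three {d : ℤ} (hd : d = 3 ∨ d = -3) :
    ∃ (W : WeierstrassCurve ℚ) (_ : W.IsElliptic) (_ : W.IsGloballyMinimal) (C : VariableChange ℚ),
      C • V.quadraticTwist (d : ℚ) = W := by
  haveI := V.isElliptic_quadraticTwist (cast_ne_zero_of_pm_three hd)
  obtain ⟨C, hCmin⟩ := hasGlobalMinimalModel_rat_holds (V.quadraticTwist (d : ℚ))
  exact ⟨C • V.quadraticTwist (d : ℚ), inferInstance, hCmin, C, rfl⟩

omit [V.IsElliptic] in
/-- **The twist pair is symmetric**: if `C • V^{(d)} = W` then `C' • W^{(d)} = V` for some `C'` (`d ≠ 0`): twisting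
commutes with a change of variables up to an explicit one (`quadraticTwist_smul`), `(V^{(d)})^{(d)} = V^{(d·d)}`
(`quadraticTwist_quadraticTwist`) and `V^{(d²)} ≅ V^{(1)} ≅ V` over `ℚ`
(`exists_variableChange_quadraticTwist_mul_sq`, `exists_variableChange_quadraticTwist_one`). So the
`χ₋₃`-twist is an INVOLUTION on `ℚ`-isomorphism classes, and every statement of this file read from `W` to `V`.
[cite: SilvermanAEC2009, X.2 Prop. 2.4 and X.5 Cor. 5.4] -/
theorem exists_variableChange_twist_symm (W : WeierstrassCurve ℚ) {d : ℚ} (hd : d ≠ 0)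
    (C : VariableChange ℚ) (hC : C • V.quadraticTwist d = W) :
    ∃ C' : VariableChange ℚ, C' • W.quadraticTwist d = V := by
  obtain ⟨C₁, hC₁⟩ := V.exists_variableChange_quadraticTwist_mul_sq 1 d hd
  obtain ⟨C₀, hC₀⟩ := V.exists_variableChange_quadraticTwist_one
  have hWd : W.quadraticTwist d =
      ((⟨C.u, d * C.r, 0, 0⟩ : VariableChange ℚ) * C₁ * C₀) • V := by
    rw [← hC, WeierstrassCurve.quadraticTwist_smul, quadraticTwist_quadraticTwist, mul_smul, mul_smul, hC₀, hC₁]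
    congr 2; ring
  exact ⟨((⟨C.u, d * C.r, 0, 0⟩ : VariableChange ℚ) * C₁ * C₀)⁻¹, by rw [hWd, inv_smul_smul]⟩

end Symmetry

/-! ### §11 Summary on the principal-series rows of K1/K2 -/

section Summary

variable (V W : WeierstrassCurve ℚ) [V.IsElliptic] [V.IsGloballyMinimal] [W.IsElliptic] [W.IsGloballyMinimal]

/-- **LAW L-tw3 (the `χ₋₃`-twist involution of the principal-series rows), summary.** For `V` on a PS row of the
cruxes `PSRankOneLowerHalfAtThree` / `PSRankOneUpperHalfAtThree` (`ClassO6 V 3`, `v := v₃Δ_min(V)` even,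
`Δ_min/3^v ≡ 1 (mod 3)`) and a globally minimal model `W` of `V ⊗ χ₋₃` (`C • V^{(−3)} = W`): `W` is again on a PS
row, `v₃Δ_min(W) = v + 6` (`v ≤ 6`: `II → IV*`, `IV → II*`) or `v − 6` (`IV* → II`, `II* → IV`), the local root
number at `3` flips (`W₃(W) = −W₃(V)`), and `N(W) = N(V)`. The two rows exchanged are the `η`-order-`3` and the
`η`-order-`6` rows of the route (`η₆ = η₃·χ₋₃`, one untwist newform `g` for the pair); analytic rank and `ρ̄₃`
are not claimed to be preserved. [cite: Kraus1990, Théorème (p = 3)] [cite: Rizzo2003, Table II (p. 4)]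
[cite: SilvermanAEC2009, X.2 Prop. 2.4 and C.16] -/
theorem twist_involution_of_psRow (hO6 : ClassO6 V 3) (hev : Even (padicValInt 3 V.minimalDiscriminantInt))
    (hps : V.minimalDiscriminantInt / 3 ^ padicValInt 3 V.minimalDiscriminantInt % 3 = 1)
    (C : VariableChange ℚ) (hC : C • V.quadraticTwist ((-3 : ℤ) : ℚ) = W) :
    (ClassO6 W 3 ∧ Even (padicValInt 3 W.minimalDiscriminantInt) ∧
        W.minimalDiscriminantInt / 3 ^ padicValInt 3 W.minimalDiscriminantInt % 3 = 1) ∧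
      padicValInt 3 W.minimalDiscriminantInt =
        (if padicValInt 3 V.minimalDiscriminantInt ≤ 6 then padicValInt 3 V.minimalDiscriminantInt + 6
          else padicValInt 3 V.minimalDiscriminantInt - 6) ∧
      W.rootNumberThree = -V.rootNumberThree ∧ W.conductorNorm ℤ = V.conductorNorm ℤ :=
  have hd : (-3 : ℤ) = 3 ∨ (-3 : ℤ) = -3 := Or.inr rfl
  ⟨psRow_twist_of_psRow V W hO6 hev hps hd C hC,
    padicValInt_minimalDiscriminantInt_twist_eq_ite V W hO6 hev hd C hC,
    rootNumberThree_twist_of_psRow V W hO6 hev hps hd C hC,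
    conductorNorm_twist_negThree_of_cyclic V W hO6 hev C hC⟩

end Summary

end Summit.BirchSwinnertonDyer.BirchSwinnertonDyer.Theorems.PSTwistInvolution
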